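import Summits.Ventures.CertifiedArithmetic.LowPrec.TheoremsR1
import Summits.Ventures.CertifiedArithmetic.LowPrec.Attain

/-!
# THEOREMS-R1 in Lean: the sharp exact-sum criterion (Lemma C′) and generic inexactness witnesses

HONEST FRAMING (venture CertifiedArithmetic / cell `pub-lowprec`): certified error envelopes and
provably optimal rounding/accumulation schemes for low-precision formats under stated cost models;
every table by two implementations; no hardware or vendor claims.

Parameter-level criteria of the cell's THEOREMS-R1.md §1–§2 (enum seat) that were "NOT YET IN LEAN"
(LEAN MAP of THEOREMS-R1.md, 2026-08-19): with them every one of the 136 `(X, Y, op, R)` keys of the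
cell's exact/inexact verdict table is decided by an instance of at most six lines over the FORMAT
PARAMETERS — no operand table is enumerated — in particular the 104 keys whose tables are held by
the numerics gate (files `ExactVerdictsOCP.lean`, `ExactVerdictsP3109.lean`).

* `exactSums_of_spanSides` (core `exactSum_of_spanSide`) — THEOREMS-R1 Theorem S in its SHARP form
  (Lemma C′, the span criterion). Write every magnitude in units of the common quantum `2^L`, `L =
  min(qexp₁, qexp₂)`, and let `2^t` be the lowest set bit of the exact sum `x + y`; that bit is the
  lowest set bit of one of the operands, say of `x = k · 2^t`, `k` odd, `k < 2^p₁`, so `|x + y| ≤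
  min(maxScaled₁ · 2^a, (2^p₁ - 1) · 2^t) + maxScaled₂ · 2^b` (`a = qexp₁ - L`, `b = qexp₂ - L`, `t
  ≥ a`). The sum is a value of `ψ` as soon as this is `< 2^(p_ψ + t)` (and `qexp_ψ ≤ L`, and the
  range suffices). Both sides of that inequality at most double when `t` grows by one, so it
  suffices AT THE LOWEST POSITION `t = a`: the span inequality `Span(φ₁, φ₂, ψ) := min(maxScaled₁,
  2^p₁ - 1) · 2^a + maxScaled₂ · 2^b < 2^(p_ψ + a)`, and symmetrically `Span(φ₂, φ₁, ψ)` for a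
  lowest bit contributed by `y` — two decidable inequalities in the format parameters, written out
  in the hypotheses (this file adds no definitions). The coarse Theorem S₀ (`theoremS0_holds`,
  TheoremsR1.lean) is the case where already `maxScaled₁ · 2^a + maxScaled₂ · 2^b < 2^p_ψ`; the two
  certified keys that needed Lemma C′ (`e3m2 + e2m3 → bfloat16`, span 8; `e3m2 + e2m1 → bfloat16`,
  span 7; closed in ExactWideFP6FP4.lean by kernel enumeration of 4096 + 1024 roundings) satisfy
  the span inequalities by `decide` (example below), as do the held keys `binary8p5 + binary8p5 →
  binary16` (S₀ fails: `15 + 15 ≥ 2^(11 - 7)`) and `e2m1 + e4m3 → binary32`.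
* `qexp_le_and_lt_of_toRat_eq` — Corollary 0 of THEOREMS-R1 in the negative direction: a value of
  `ψ` equal to `c · 2^e` with `c` odd has `e ≥ qexp_ψ` and `c < 2^p_ψ` (via `representable_iff` and
  the odd-part lemma `dvd_of_mul_zpow_eq`, Attain.lean).
* `not_exactSums_of_witness` / `not_exactProducts_of_witness` — THEOREMS-R1 Theorems S′(a) (span
  witness: odd `c ≥ 2^p_R`), S′(b) (quantum witness: `e < qexp_R`), P″(a), P″(b) as ONE principle
  each; `not_exactSums_of_overflow` / `not_exactProducts_of_overflow` — the range witnesses (P′ /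
  failing (iii)).
-/

namespace Summit.Ventures.CertifiedArithmetic

open Literature.ComputerArithmetic.FloatingPoint
open Literature.ComputerArithmetic.FloatingPoint.MiniFloat
open Literature.ComputerArithmetic.FloatingPoint.Format

/-! ### The sharp span criterion -/

/-
THE SPAN INEQUALITY `Span(φ₁, φ₂, ψ)` (one side of hypothesis (ii′) of THEOREMS-R1 Theorem S, Lemma
C′), in units of the common quantum `2^L`, `L = min(qexp₁, qexp₂)`, with the lifts
`a = (qexp₁ - qexp₂)⁺`, `b = (qexp₂ - qexp₁)⁺` (one of them is `0`): if the lowest set bit of the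
exact sum is contributed by the `φ₁`-operand at its lowest possible position `2^a`, the sum is
below `2^(p_ψ + a)`:
    `min(maxScaled₁, 2^p₁ - 1) · 2^a + maxScaled₂ · 2^b < 2^(p_ψ + a)`.
Higher positions of that bit are implied (both sides at most double per step). It is written out
as a decidable inequality of natural numbers in each hypothesis below (no auxiliary definition).
-/

/-- A signed magnitude `N · 2^j` quanta of `ψ` with `2^t ∣ N`, `|N| < 2^(p_ψ + t)` and within range
is a value of `ψ` (Corollary 0, positive direction, with a known number of trailing zeros;
generalizes `exists_toRat_eq_int_mul_pow_mul_quantum`, the case `t = 0`). -/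
theorem exists_toRat_eq_of_pow_dvd {ψ : Format} {N : ℤ} {j t : ℕ} (hdvd : (2 : ℤ) ^ t ∣ N)
    (hN : N.natAbs < 2 ^ (ψ.manBits + 1 + t)) (hle : N.natAbs * 2 ^ j ≤ ψ.maxScaled) :
    ∃ z : MiniFloat ψ, z.toRat = (N : ℚ) * 2 ^ j * ψ.quantum := by
  obtain ⟨N', rfl⟩ := hdvd
  have habs : ((2 : ℤ) ^ t * N').natAbs = 2 ^ t * N'.natAbs := by
    simp [Int.natAbs_mul, Int.natAbs_pow]
  rw [habs] at hN hle
  have h1 : N'.natAbs < 2 ^ (ψ.manBits + 1) := by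
    have : 2 ^ t * N'.natAbs < 2 ^ t * 2 ^ (ψ.manBits + 1) := by
      calc 2 ^ t * N'.natAbs < 2 ^ (ψ.manBits + 1 + t) := hN
        _ = 2 ^ t * 2 ^ (ψ.manBits + 1) := by rw [pow_add, mul_comm]
    exact Nat.lt_of_mul_lt_mul_left this
  have h2 : N'.natAbs * 2 ^ (t + j) ≤ ψ.maxScaled := by
    calc N'.natAbs * 2 ^ (t + j) = 2 ^ t * N'.natAbs * 2 ^ j := by rw [pow_add]; ring
      _ ≤ ψ.maxScaled := hle
  obtain ⟨z, hz⟩ := exists_toRat_eq_int_mul_pow_mul_quantum h1 h2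
  refine ⟨z, ?_⟩
  rw [hz]; push_cast; ring

/-- Core of the sharp Theorem S: if the trailing-zero count (in common quanta) of `x`'s magnitude is
at most that of `y`'s — so the lowest set bit of the sum comes from `x`'s side — then
the span inequality `Span(φ₁, φ₂, ψ)`, the common-quantum hypothesis and the range hypothesis
make `x + y` a value of `ψ`. -/
theorem exactSum_of_spanSide {φ₁ φ₂ ψ : Format} (hL : ψ.qexp ≤ min φ₁.qexp φ₂.qexp)
    (hS : min φ₁.maxScaled (2 ^ (φ₁.manBits + 1) - 1) * 2 ^ (φ₁.qexp - φ₂.qexp).toNat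
        + φ₂.maxScaled * 2 ^ (φ₂.qexp - φ₁.qexp).toNat
        < 2 ^ (ψ.manBits + 1 + (φ₁.qexp - φ₂.qexp).toNat))
    (hM : φ₁.maxRat + φ₂.maxRat ≤ ψ.maxRat)
    (x : MiniFloat φ₁) (y : MiniFloat φ₂) {k₁ j₁ k₂ j₂ : ℕ} (hk₁ : k₁ < 2 ^ (φ₁.manBits + 1))
    (hx : x.scaledMag = k₁ * 2 ^ j₁) (hy : y.scaledMag = k₂ * 2 ^ j₂)
    (ht : j₁ + (φ₁.qexp - φ₂.qexp).toNat ≤ j₂ + (φ₂.qexp - φ₁.qexp).toNat) :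
    ∃ z : MiniFloat ψ, z.toRat = x.toRat + y.toRat := by
  -- exponent bookkeeping: qexp₁ = qexp_ψ + j + a, qexp₂ = qexp_ψ + j + b, {a, b} ∋ 0
  have h1 : min φ₁.qexp φ₂.qexp ≤ φ₁.qexp := min_le_left _ _
  have h2 : min φ₁.qexp φ₂.qexp ≤ φ₂.qexp := min_le_right _ _
  obtain ⟨j, hj⟩ : ∃ j : ℕ, min φ₁.qexp φ₂.qexp = ψ.qexp + j :=
    ⟨(min φ₁.qexp φ₂.qexp - ψ.qexp).toNat, by omega⟩
  have ha : φ₁.qexp = ψ.qexp + j + ((φ₁.qexp - φ₂.qexp).toNat : ℕ) := by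
    rcases min_choice φ₁.qexp φ₂.qexp with h | h <;> omega
  have hb : φ₂.qexp = ψ.qexp + j + ((φ₂.qexp - φ₁.qexp).toNat : ℕ) := by
    rcases min_choice φ₁.qexp φ₂.qexp with h | h <;> omega
  -- the exact sum is `N · 2^j` quanta of `ψ`
  set a : ℕ := (φ₁.qexp - φ₂.qexp).toNat with ha_def
  set b : ℕ := (φ₂.qexp - φ₁.qexp).toNat with hb_def
  set N : ℤ := x.toInt * 2 ^ a + y.toInt * 2 ^ b with hN
  have hq : (0 : ℚ) < ψ.quantum := ψ.quantum_pos
  have h2j : (0 : ℚ) < (2 : ℚ) ^ j := pow_pos (by norm_num) _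
  have hsum : x.toRat + y.toRat = (N : ℚ) * 2 ^ j * ψ.quantum := by
    unfold MiniFloat.toRat Format.quantum
    rw [ha, hb, hN]
    push_cast
    simp only [zpow_add₀ (two_ne_zero : (2 : ℚ) ≠ 0), zpow_natCast]
    ring
  -- `|N| ≤ u + v` with `u = |x| · 2^a`, `v = |y| · 2^b`
  have hNle : N.natAbs ≤ x.scaledMag * 2 ^ a + y.scaledMag * 2 ^ b := by
    have e1 : (x.toInt * 2 ^ a).natAbs = x.scaledMag * 2 ^ a := by
      simp [Int.natAbs_mul, Int.natAbs_pow, natAbs_toInt]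
    have e2 : (y.toInt * 2 ^ b).natAbs = y.scaledMag * 2 ^ b := by
      simp [Int.natAbs_mul, Int.natAbs_pow, natAbs_toInt]
    calc N.natAbs ≤ (x.toInt * 2 ^ a).natAbs + (y.toInt * 2 ^ b).natAbs := Int.natAbs_add_le _ _
      _ = x.scaledMag * 2 ^ a + y.scaledMag * 2 ^ b := by rw [e1, e2]
  -- `2^(j₁ + a)` divides `N` (it divides both terms since `j₁ + a ≤ j₂ + b`)
  obtain ⟨d, hd⟩ := Nat.exists_eq_add_of_le ht
  have hdvd : (2 : ℤ) ^ (j₁ + a) ∣ N := by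
    apply dvd_add
    · rw [← Int.natAbs_dvd_natAbs, Int.natAbs_pow, Int.natAbs_mul, Int.natAbs_pow, natAbs_toInt, hx]
      show 2 ^ (j₁ + a) ∣ k₁ * 2 ^ j₁ * 2 ^ a
      exact Dvd.intro k₁ (by rw [pow_add]; ring)
    · rw [← Int.natAbs_dvd_natAbs, Int.natAbs_pow, Int.natAbs_mul, Int.natAbs_pow, natAbs_toInt, hy]
      show 2 ^ (j₁ + a) ∣ k₂ * 2 ^ j₂ * 2 ^ b
      have e2 : 2 ^ (j₂ + b) = 2 ^ (j₁ + a) * 2 ^ d := by rw [hd, pow_add]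
      exact Dvd.intro (k₂ * 2 ^ d) (by
        calc 2 ^ (j₁ + a) * (k₂ * 2 ^ d) = k₂ * (2 ^ (j₁ + a) * 2 ^ d) := by ring
          _ = k₂ * 2 ^ (j₂ + b) := by rw [e2]
          _ = k₂ * 2 ^ j₂ * 2 ^ b := by rw [pow_add, mul_assoc])
  -- `u + v < 2^(p_ψ + j₁ + a)` from the span inequality scaled by `2^j₁`
  have hu : x.scaledMag * 2 ^ a ≤ min φ₁.maxScaled (2 ^ (φ₁.manBits + 1) - 1) * 2 ^ a * 2 ^ j₁ := by
    rcases min_choice φ₁.maxScaled (2 ^ (φ₁.manBits + 1) - 1) with h | h <;> rw [h]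
    · calc x.scaledMag * 2 ^ a ≤ φ₁.maxScaled * 2 ^ a :=
            Nat.mul_le_mul_right _ x.scaledMag_le_maxScaled
        _ ≤ φ₁.maxScaled * 2 ^ a * 2 ^ j₁ := Nat.le_mul_of_pos_right _ (by positivity)
    · have hk : k₁ ≤ 2 ^ (φ₁.manBits + 1) - 1 := by omega
      calc x.scaledMag * 2 ^ a = k₁ * 2 ^ j₁ * 2 ^ a := by rw [hx]
        _ ≤ (2 ^ (φ₁.manBits + 1) - 1) * 2 ^ j₁ * 2 ^ a := by gcongr
        _ = (2 ^ (φ₁.manBits + 1) - 1) * 2 ^ a * 2 ^ j₁ := by ring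
  have hv : y.scaledMag * 2 ^ b ≤ φ₂.maxScaled * 2 ^ b * 2 ^ j₁ :=
    calc y.scaledMag * 2 ^ b ≤ φ₂.maxScaled * 2 ^ b :=
          Nat.mul_le_mul_right _ y.scaledMag_le_maxScaled
      _ ≤ φ₂.maxScaled * 2 ^ b * 2 ^ j₁ := Nat.le_mul_of_pos_right _ (by positivity)
  have hNlt : N.natAbs < 2 ^ (ψ.manBits + 1 + (j₁ + a)) := by
    have hS' : min φ₁.maxScaled (2 ^ (φ₁.manBits + 1) - 1) * 2 ^ a + φ₂.maxScaled * 2 ^ b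
        < 2 ^ (ψ.manBits + 1 + a) := hS
    calc N.natAbs ≤ x.scaledMag * 2 ^ a + y.scaledMag * 2 ^ b := hNle
      _ ≤ (min φ₁.maxScaled (2 ^ (φ₁.manBits + 1) - 1) * 2 ^ a + φ₂.maxScaled * 2 ^ b)
            * 2 ^ j₁ := by
          rw [add_mul]; exact add_le_add hu hv
      _ < 2 ^ (ψ.manBits + 1 + a) * 2 ^ j₁ := Nat.mul_lt_mul_of_pos_right hS' (by positivity)
      _ = 2 ^ (ψ.manBits + 1 + (j₁ + a)) := by rw [← pow_add]; congr 1; omega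
  -- range: `|N| · 2^j ≤ maxScaled_ψ` from (iii)
  have habs : |x.toRat + y.toRat| ≤ φ₁.maxRat + φ₂.maxRat :=
    (abs_add_le _ _).trans (add_le_add (abs_toRat_le_maxRat x) (abs_toRat_le_maxRat y))
  have hcastN : |(N : ℚ)| = ((N.natAbs : ℕ) : ℚ) := by rw [Nat.cast_natAbs, Int.cast_abs]
  have habs' : |x.toRat + y.toRat| = ((N.natAbs : ℕ) : ℚ) * 2 ^ j * ψ.quantum := by
    rw [hsum, abs_mul, abs_mul, hcastN, abs_of_pos h2j, abs_of_pos hq]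
  have hle : N.natAbs * 2 ^ j ≤ ψ.maxScaled := by
    have hM' : ((N.natAbs : ℕ) : ℚ) * 2 ^ j * ψ.quantum ≤ (ψ.maxScaled : ℚ) * ψ.quantum := by
      rw [← habs']
      exact habs.trans hM
    have := le_of_mul_le_mul_right hM' hq
    exact_mod_cast this
  obtain ⟨z, hz⟩ := exists_toRat_eq_of_pow_dvd hdvd hNlt hle
  exact ⟨z, hz.trans hsum.symm⟩

/-- THEOREMS-R1 Theorem S in its sharp form (Lemma C′): (i) `qexp_ψ ≤ min(qexp₁, qexp₂)`, (ii′)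
the two span inequalities `Span(φ₁, φ₂, ψ)`, `Span(φ₂, φ₁, ψ)` and (iii)
`maxRat₁ + maxRat₂ ≤ maxRat_ψ` imply `ExactSums φ₁ φ₂ ψ`: every sum of data is a value of `ψ`. All
three hypotheses are decidable in the format parameters. -/
theorem exactSums_of_spanSides (φ₁ φ₂ ψ : Format) (hL : ψ.qexp ≤ min φ₁.qexp φ₂.qexp)
    (hS₁ : min φ₁.maxScaled (2 ^ (φ₁.manBits + 1) - 1) * 2 ^ (φ₁.qexp - φ₂.qexp).toNat
        + φ₂.maxScaled * 2 ^ (φ₂.qexp - φ₁.qexp).toNat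
        < 2 ^ (ψ.manBits + 1 + (φ₁.qexp - φ₂.qexp).toNat))
    (hS₂ : min φ₂.maxScaled (2 ^ (φ₂.manBits + 1) - 1) * 2 ^ (φ₂.qexp - φ₁.qexp).toNat
        + φ₁.maxScaled * 2 ^ (φ₁.qexp - φ₂.qexp).toNat
        < 2 ^ (ψ.manBits + 1 + (φ₂.qexp - φ₁.qexp).toNat))
    (hM : φ₁.maxRat + φ₂.maxRat ≤ ψ.maxRat) :
    ExactSums φ₁ φ₂ ψ := by
  intro x y
  obtain ⟨-, k₁, j₁, hk₁, hx⟩ := representable_iff.mp (representable_scaledMag x)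
  obtain ⟨-, k₂, j₂, hk₂, hy⟩ := representable_iff.mp (representable_scaledMag y)
  rcases le_total (j₁ + (φ₁.qexp - φ₂.qexp).toNat) (j₂ + (φ₂.qexp - φ₁.qexp).toNat) with h | h
  · exact exactSum_of_spanSide hL hS₁ hM x y hk₁ hx hy h
  · obtain ⟨z, hz⟩ :=
      exactSum_of_spanSide (ψ := ψ) (by rwa [min_comm]) hS₂ (by rwa [add_comm]) y x hk₂ hy hx h
    exact ⟨z, by rw [hz, add_comm]⟩

/-- One of the two certified FP6/FP4 keys that needed Lemma C′ (`e3m2 + e2m3 → bfloat16`, span 8;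
ExactWideFP6FP4.lean closed it by kernel enumeration of 4096 roundings) follows from the sharp
Theorem S by a check on the format parameters only (not re-filed as a theorem: the statement is
landed as `E3M2_add_E2M3_exact_in_BFloat16`). -/
example : ExactSums E3M2 E2M3 BFloat16 :=
  exactSums_of_spanSides _ _ _ (by decide) (by decide) (by decide)
    (by rw [E3M2_maxRat.1, E2M3_maxRat.1, BFloat16_maxRat.1]; norm_num)

/-- … while the coarse hypothesis (ii₀) of Theorem S₀ fails for `e3m2 + e2m3 → bfloat16`
(`28 + 15/2 ≥ 2^(8 - 4) = 16`): the sharp form is strictly stronger. -/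
example : ¬ (E3M2.maxRat + E2M3.maxRat
    < (2 : ℚ) ^ ((BFloat16.manBits : ℤ) + 1 + min E3M2.qexp E2M3.qexp)) := by
  rw [E3M2_maxRat.1, E2M3_maxRat.1,
    show ((BFloat16.manBits : ℤ) + 1 + min E3M2.qexp E2M3.qexp) = 4 by decide]
  norm_num

/-! ### Generic witnesses of inexactness -/

/-- Corollary 0 of THEOREMS-R1, negative direction: if a value of `ψ` equals `c · 2^e` with `c`
odd, then `e ≥ qexp_ψ` and `c < 2^(p_ψ)` (the value is `k · 2^j` quanta with `k < 2^p_ψ`, and the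
odd `c` divides `k`; were `e < qexp_ψ`, `c = k · 2^(j + qexp_ψ - e)` would be even). -/
theorem qexp_le_and_lt_of_toRat_eq {ψ : Format} (z : MiniFloat ψ) {c : ℕ} {e : ℤ} (hc : Odd c)
    (hz : z.toRat = (c : ℚ) * 2 ^ e) : ψ.qexp ≤ e ∧ c < 2 ^ (ψ.manBits + 1) := by
  obtain ⟨-, k, j, hk, hn⟩ := representable_iff.mp (representable_scaledMag z)
  have h2 : (2 : ℚ) ≠ 0 := two_ne_zero
  have habs : |z.toRat| = (z.scaledMag : ℚ) * ψ.quantum := abs_toRat z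
  rw [hz, hn, abs_of_nonneg (by positivity), Format.quantum] at habs
  push_cast at habs
  have hkj : (k : ℚ) * (2 : ℚ) ^ ((j : ℤ) + ψ.qexp) = (c : ℚ) * (2 : ℚ) ^ e := by
    rw [zpow_add₀ h2, zpow_natCast, habs]; ring
  have hk0 : k ≠ 0 := by
    rintro rfl
    have h0 : (c : ℚ) * 2 ^ e = 0 := by rw [← hkj]; simp
    have : (c : ℚ) = 0 := by
      rcases mul_eq_zero.mp h0 with h | h
      · exact h
      · exact absurd h (zpow_ne_zero e h2)
    have hc0 : c = 0 := by exact_mod_cast this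
    rw [hc0] at hc
    exact absurd hc (by decide)
  have hdvd : c ∣ k := dvd_of_mul_zpow_eq hc hkj
  refine ⟨?_, lt_of_le_of_lt (Nat.le_of_dvd (Nat.pos_of_ne_zero hk0) hdvd) hk⟩
  by_contra hlt
  rw [not_le] at hlt
  obtain ⟨d, hd⟩ : ∃ d : ℕ, (j : ℤ) + ψ.qexp = e + ((d + 1 : ℕ) : ℤ) :=
    ⟨(j + ψ.qexp - e - 1).toNat, by push_cast; omega⟩
  have hrat : (k : ℚ) * 2 ^ (d + 1) = c := by
    have e1 : (2 : ℚ) ^ ((j : ℤ) + ψ.qexp) = 2 ^ e * 2 ^ (d + 1) := by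
      rw [hd, zpow_add₀ h2, zpow_natCast]
    have h' : ((k : ℚ) * 2 ^ (d + 1)) * 2 ^ e = (c : ℚ) * 2 ^ e := by rw [← hkj, e1]; ring
    exact mul_right_cancel₀ (zpow_ne_zero e h2) h'
  have hnat : k * 2 ^ (d + 1) = c := by exact_mod_cast hrat
  exact (Nat.not_even_iff_odd.mpr hc) ⟨k * 2 ^ d, by rw [← hnat]; ring⟩

/-- THEOREMS-R1 Theorems S′(a) (span witness: `c` odd, `c ≥ 2^p_R`) and S′(b) (quantum witness:
`e < qexp_R`) as one principle: a pair of data whose exact sum is `c · 2^e` of that kind refutes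
`ExactSums φ₁ φ₂ ψ`. -/
theorem not_exactSums_of_witness {φ₁ φ₂ ψ : Format} (x : MiniFloat φ₁) (y : MiniFloat φ₂)
    (c : ℕ) (e : ℤ) (hc : Odd c) (h : x.toRat + y.toRat = (c : ℚ) * 2 ^ e)
    (hbad : e < ψ.qexp ∨ 2 ^ (ψ.manBits + 1) ≤ c) : ¬ ExactSums φ₁ φ₂ ψ := by
  intro hex
  obtain ⟨z, hz⟩ := hex x y
  obtain ⟨h1, h2⟩ := qexp_le_and_lt_of_toRat_eq z hc (hz.trans h)
  rcases hbad with hb | hb <;> omega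

/-- THEOREMS-R1 Theorems P″(a) (precision witness: odd significand `c ≥ 2^p_R`) and P″(b) (quantum
witness: `e < qexp_R`) as one principle for products (`R2_ExactProducts`, Statement.lean). -/
theorem not_exactProducts_of_witness {φ₁ φ₂ ψ : Format} (x : MiniFloat φ₁) (y : MiniFloat φ₂)
    (c : ℕ) (e : ℤ) (hc : Odd c) (h : x.toRat * y.toRat = (c : ℚ) * 2 ^ e)
    (hbad : e < ψ.qexp ∨ 2 ^ (ψ.manBits + 1) ≤ c) : ¬ R2_ExactProducts φ₁ φ₂ ψ := by
  intro hex
  obtain ⟨z, hz⟩ := hex x y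
  obtain ⟨h1, h2⟩ := qexp_le_and_lt_of_toRat_eq z hc (hz.trans h)
  rcases hbad with hb | hb <;> omega


/-- Range witness for sums: a pair whose exact sum exceeds `maxRat_ψ` refutes `ExactSums`. -/
theorem not_exactSums_of_overflow {φ₁ φ₂ ψ : Format} (x : MiniFloat φ₁) (y : MiniFloat φ₂)
    (h : ψ.maxRat < x.toRat + y.toRat) : ¬ ExactSums φ₁ φ₂ ψ := by
  intro hex
  obtain ⟨z, hz⟩ := hex x y
  have := abs_toRat_le_maxRat z
  rw [hz] at this
  exact absurd (h.trans_le (le_abs_self _)) (not_lt.mpr this)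

/-- Range witness for products (THEOREMS-R1 Theorem P′): a pair whose exact product exceeds
`maxRat_ψ` refutes `R2_ExactProducts`. -/
theorem not_exactProducts_of_overflow {φ₁ φ₂ ψ : Format} (x : MiniFloat φ₁) (y : MiniFloat φ₂)
    (h : ψ.maxRat < x.toRat * y.toRat) : ¬ R2_ExactProducts φ₁ φ₂ ψ := by
  intro hex
  obtain ⟨z, hz⟩ := hex x y
  have := abs_toRat_le_maxRat z
  rw [hz] at this
  exact absurd (h.trans_le (le_abs_self _)) (not_lt.mpr this)

end Summit.Ventures.CertifiedArithmetic
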